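import Summits.BirchSwinnertonDyer.BirchSwinnertonDyer.Theorems.PrintX9HowardContainmentLightFramePinnedOfPrintSharpOfMuPart
import HarnessLib

/-!
# BC5 / T3 witness rung BY ID for the row-9 deciding crux `PrintX9.HowardContainmentLightFramePinnedOfPrintSharp`
# (stmt-BirchSwinnertonDyer-27077, PrintX9 rev 33/34) — LEVER REGIME, any class number, `p`-localized, TIED

Seat: tribunal-w `bsd-trib-w-tld` g6 (bc5-witness planner, D-0154 KEY (146) row 9; host `pub/bsd-print-x9`).
Helper file (`--supports stmt-BirchSwinnertonDyer-27077 --as helper`); no stub of the registered skeleton is touched.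

WHAT. The deciding crux is `MZ → NV → CGS → Tower♯ → A^pin` with
`A^pin = HowardContainmentLightFramePinned` (light X9 frame, pin `¬ (p : ℤ) ∣ Dt.c`, rank one, `Ш[p^∞]` finite, TIED
conclusion `∃ jbar D F X, F.Dt = Dt ∧ I(ℋ_F)² ≤ char_Λ(X_tors)`). The g5 witness of record-to-be
(`PrintX9Rung.rung_lightPinned_coprimeClassNumber`, p616846) is the `p ∤ h_K` slice of `A^pin` from the binder `hMZ`
(PRINT regime, Mastella–Zerman 2026 Cor. 4.6). THIS file adds the complementary LEVER-REGIME rung, again BY ID over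
binders of `closes`: from `hNV` (CGLS 2022 Thm. 4.1.1, item 27103), `hCGS` (CGS 2025 Thm. 6.5.2, item 27112) and `hTw`
(Tower♯, item 27076) ALONE — no `hMZ`, NO class-number hypothesis — the letter of `A^pin` with its conclusion
TRUNCATED by a power of `p`:
`∃ jbar D F X m, F.Dt = Dt ∧ (p^m)·I(ℋ_F)² ≤ char_Λ(X_tors)` (`rung_sharp_localizedTied`), together with the full
localized package `𝔖` f.g., `𝔛` f.g., `𝔖/ℋ_F` Λ-torsion (`rung_sharp_localizedPackage`) — i.e. the antecedent of the
LEAD's residual `PrintX9SharpMuPart.Stmt.muPartSharp` holds UNCONDITIONALLY at every light pinned frame. It uses the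
route's lever by name: the print-free module-level envelope `PrintX9SharpEnvelope.stub_envelopeModulesSharp`
(p621799) and `PrintX9SharpMuPart.package_of_envelopeModules` (x9-p1 LEAD).

T3 reading. A proved TRUNCATION of the deciding crux's conclusion (BC5: «special case / truncation … OF C») in the
regime `p ∣ h_K` where neither S (`Rank1Residual.BSDpOnClassX9`: small image, BCS25 Thm. 1.1.2 (b) needs (sur)/(im))
nor the crux's integral conclusion is in print (MZ26 Ass. 2.1 (iii) needs `p ∤ h_K`; CGS 6.5.2 / CGLS 4.1.3 are
`Λ[1/p]` statements), exercising the route's lever (torsion-depth envelope at `p ∣ h_K`). What separates the rung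
from the crux is EXACTLY the μ-part (`muPartSharp_iff_integralTied_at_dvd`: given the three binders, the registered
residual stub is equivalent to the bare integral TIED containment at the `p ∣ h_K` frames). Certificates
`rung_isTruncation_of_pinned` / `rung_isTruncation_of_sharp` record that the rung IS a weakening of `A^pin` / of the
crux given its binders (kernel bookkeeping).

«beyond-print theorem»: no (every input is a closes binder stated from print, or landed kernel geometry).
BSD / BSD_p(X9) / the crux / its residual are NOT proved by this file.
-/

set_option autoImplicit false
set_option linter.dupNamespace false

open scoped Classical Pointwise
open Literature Literature.NumberTheory.EllipticCurves WeierstrassCurve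
  Literature.NumberTheory.EllipticCurves.ModularForms
open Summit.BirchSwinnertonDyer.BirchSwinnertonDyer.Theses.PrintX9

namespace Summit.BirchSwinnertonDyer.BirchSwinnertonDyer.Theorems.PrintX9SharpRung

/-! ## §1 The localized TIED package at a GIVEN `jbar`, from the three lever binders (any class number) -/

/-- **Localized tied containment package on a light pinned X9 frame at a GIVEN `jbar`, ANY class number**, from the
route binders `hNV` (CGLS 4.1.1), `hCGS` (CGS 6.5.2), `hTw` (Tower♯) BY NAME: data `D`, `X` exist (tree existence
theorems); the print-free envelope `stub_envelopeModulesSharp hTw` gives a Heegner family `F` ON `Dt` squeezed against a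
stabilised CGLS datum `C` (`p^e·ℋ_F ≤ Λκ_∞(C)`, `g·Λκ_∞(C) ≤ ℋ_F`, `g ≠ 0`); `package_of_envelopeModules` (hypotheses
`Thm413Hypotheses` by `X9.thm413Hypotheses_of_lightFrame`, no class-number input) yields `𝔖` f.g., `𝔛` f.g., `𝔖/ℋ_F`
torsion and `(p^m)·I(ℋ_F)² ⊆ char_Λ(X_tors)`. Rank / Ш are not needed and not assumed.
[cite: CastellaGrossiLeeSkinner2022, Thm. 4.1.1 and Rem. 4.1.4 (arXiv:2008.02571)]
[cite: CastellaGrossiSkinner2025, Thm. 6.5.2 (arXiv:2303.04373)] [cite: PerrinRiou1987BSMF, §3 (ring class tower)] -/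
theorem localizedTiedPackageAt_of_sharpBinders
    (hNV : CGLSHeegnerClassNonvanishing) (hCGS : CGSHowardDivisibilityPLocalized)
    (hTw : AnticyclotomicTowerSharp)
    {W : WeierstrassCurve ℚ} [W.IsElliptic] [W.IsGloballyMinimal] {p : ℕ} [Fact p.Prime]
    [NeZero (W.conductorNorm ℤ)] {K : Type} [Field K] [NumberField K]
    (hX9 : Summit.BirchSwinnertonDyer.BirchSwinnertonDyer.Rank1Residual.ClassX9 W p)
    (hK : IsImaginaryQuadratic K) (hodd : Odd (NumberField.discr K)) (h3 : NumberField.discr K ≠ -3)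
    (hHN : SatisfiesHeegnerHypothesis (W.conductorNorm ℤ) K) (hHp : SatisfiesHeegnerHypothesis p K)
    (hirr : (W.baseChange K).HasIrreducibleModPGaloisRep p)
    (κ : ZpExtension K p) (hκ : κ.IsAnticyclotomic)
    (γ : Field.absoluteGaloisGroup K) (hγ : κ.IsTopGenerator γ)
    (Dt : ModularParametrizationData W (W.conductorNorm ℤ))
    (H : HeegnerDatum (W.conductorNorm ℤ) (NumberField.discr K))
    (jbar : AlgebraicClosure K →+* ℂ) (hc : ¬ (p : ℤ) ∣ Dt.c) :
    ∃ (D : (W.baseChange K).LambdaAdicSelmerData κ γ)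
      (F : HeegnerFamily (W.conductorNorm ℤ) W K κ jbar) (X : (W.baseChange K).SelmerDualData κ γ) (m : ℕ),
      F.Dt = Dt ∧ Module.Finite (IwasawaAlgebra p) X.X ∧ Module.Finite (IwasawaAlgebra p) D.S ∧
        Module.IsTorsion (IwasawaAlgebra p) (D.S ⧸ heegnerModule D F) ∧
        Ideal.span {((p : IwasawaAlgebra p) ^ m)} * heegnerCharIdeal D F ^ 2 ≤
          Module.charIdeal (IwasawaAlgebra p) (Submodule.torsion (IwasawaAlgebra p) X.X) := by
  obtain ⟨D⟩ := LambdaAdicSelmerDataExists.nonempty_lambdaAdicSelmerData (W.baseChange K) p κ hγ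
  obtain ⟨X⟩ := (W.baseChange K).nonempty_selmerDualData_holds κ γ hγ
  obtain ⟨C, F, e, g, -, hFDt, hg, hfwd, hrev⟩ :=
    Summit.BirchSwinnertonDyer.BirchSwinnertonDyer.Theorems.PrintX9SharpEnvelope.stub_envelopeModulesSharp hTw W p K
      hX9 hK hodd h3 hHN hHp hirr κ hκ γ hγ Dt H jbar D hc
  have hX9' := Summit.BirchSwinnertonDyer.BirchSwinnertonDyer.Rank1Residual.classX9_census_of_classX9 W p hX9
  have hyp := Summit.BirchSwinnertonDyer.Rank1Residual.X9.thm413Hypotheses_of_lightFrame hX9' hK hodd h3 hHN hHp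
    hκ hγ
  obtain ⟨hfinS, hfinX, htorF, m, hloc⟩ :=
    Summit.BirchSwinnertonDyer.BirchSwinnertonDyer.Theorems.PrintX9SharpMuPart.package_of_envelopeModules
      (show CastellaGrossiLeeSkinner2022.thm411_torsionFree_heegnerClass_ne_bot_quotient_isTorsion.{0} from hNV)
      (show CastellaGrossiSkinner2025.thm652_stabilized_rankOne_charIdeal_torsion_dvd_pLocalized.{0} from hCGS)
      hyp D C F X hg hfwd hrev
  exact ⟨D, F, X, m, hFDt, hfinX, hfinS, htorF, hloc⟩

/-! ## §2 THE RUNG (letter of `HowardContainmentLightFramePinned`, conclusion truncated by `p^m`) -/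

/-- **THE RUNG — BC5/T3 witness BY ID for crux stmt-BirchSwinnertonDyer-27077, LEVER REGIME.** The letter of the
route's `HowardContainmentLightFramePinned` (A^pin = the conclusion of the deciding crux
`HowardContainmentLightFramePinnedOfPrintSharp := MZ → NV → CGS → Tower♯ → A^pin`): light X9 frame, pin
`¬ (p : ℤ) ∣ Dt.c`, rank one, `Ш[p^∞]` finite, TIED — with the conclusion weakened ONLY by a power of `p`:
`∃ jbar D F X m, F.Dt = Dt ∧ (p^m)·I(ℋ_F)² ⊆ char_Λ(X_tors)`; proved from the three route binders `hNV`, `hCGS`,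
`hTw` ALONE — NO `hMZ`, NO class-number hypothesis (so it covers the `p ∣ h_K` frames, where Mastella–Zerman Cor. 4.6
is silent and `Rank1Residual.BSDpOnClassX9` is not known). `jbar := IsAlgClosed.lift` along `ιC`; rank and Ш are
carried for the letter and not used. What separates this rung from the crux is exactly the μ-part (§5).
[cite: CastellaGrossiLeeSkinner2022, Thm. 4.1.1, Rem. 4.1.4 (arXiv:2008.02571)]
[cite: CastellaGrossiSkinner2025, Thm. 6.5.2 (arXiv:2303.04373)] [cite: Howard2004HeegnerKolyvagin, Thm. B (the integral statement this truncates)] -/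
theorem rung_sharp_localizedTied
    (hNV : CGLSHeegnerClassNonvanishing) (hCGS : CGSHowardDivisibilityPLocalized)
    (hTw : AnticyclotomicTowerSharp) :
    ∀ (W : WeierstrassCurve ℚ) [W.IsElliptic] [W.IsGloballyMinimal] (p : ℕ) [Fact p.Prime]
      [NeZero (W.conductorNorm ℤ)] (K : Type) [Field K] [NumberField K],
      Summit.BirchSwinnertonDyer.BirchSwinnertonDyer.Rank1Residual.ClassX9 W p →
      IsImaginaryQuadratic K → Odd (NumberField.discr K) → NumberField.discr K ≠ -3 →
      SatisfiesHeegnerHypothesis (W.conductorNorm ℤ) K → SatisfiesHeegnerHypothesis p K →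
      (W.baseChange K).HasIrreducibleModPGaloisRep p →
      ∀ (κ : ZpExtension K p), κ.IsAnticyclotomic → ∀ (γ : Field.absoluteGaloisGroup K),
      κ.IsTopGenerator γ →
      ∀ (Dt : ModularParametrizationData W (W.conductorNorm ℤ))
        (H : HeegnerDatum (W.conductorNorm ℤ) (NumberField.discr K)) (ιC : K →+* ℂ),
      ¬ (p : ℤ) ∣ Dt.c → (W.baseChange K).mordellWeilRank = 1 →
      Finite (AddCommGroup.primaryComponent (W.baseChange K).sha p) →
      ∃ (jbar : AlgebraicClosure K →+* ℂ) (D : (W.baseChange K).LambdaAdicSelmerData κ γ)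
        (F : HeegnerFamily (W.conductorNorm ℤ) W K κ jbar) (X : (W.baseChange K).SelmerDualData κ γ) (m : ℕ),
        F.Dt = Dt ∧ Ideal.span {((p : IwasawaAlgebra p) ^ m)} * heegnerCharIdeal D F ^ 2 ≤
          Module.charIdeal (IwasawaAlgebra p) (Submodule.torsion (IwasawaAlgebra p) X.X) := by
  intro W _ _ p _ _ K _ _ hX9 hK hodd h3 hHN hHp hirr κ hκ γ hγ Dt H ιC hc _ _
  letI : Algebra K ℂ := ιC.toAlgebra
  let jbar : AlgebraicClosure K →+* ℂ :=
    (IsAlgClosed.lift (R := K) (M := ℂ) (S := AlgebraicClosure K)).toRingHom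
  obtain ⟨D, F, X, m, hFDt, -, -, -, hloc⟩ := localizedTiedPackageAt_of_sharpBinders hNV hCGS hTw hX9 hK hodd
    h3 hHN hHp hirr κ hκ γ hγ Dt H jbar hc
  exact ⟨jbar, D, F, X, m, hFDt, hloc⟩

/-- **The rung LABELLED by its regime `p ∣ h_K`** — the exact complement of the regime of the g5 witness
`PrintX9Rung.rung_lightPinned_coprimeClassNumber` (`¬ p ∣ h_K`, integral, from `hMZ`): same letter with the extra
hypothesis `p ∣ NumberField.classNumber K` in the same position; a specialisation of `rung_sharp_localizedTied` (which
needs no class-number hypothesis at all). [cite: CastellaGrossiSkinner2025, Thm. 6.5.2 (arXiv:2303.04373)]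
[cite: MastellaZerman2026, Ass. 2.1 (iii) (the p ∤ h_K hypothesis of the print regime; arXiv:2505.08710)] -/
theorem rung_sharp_localizedTied_dvdClassNumber
    (hNV : CGLSHeegnerClassNonvanishing) (hCGS : CGSHowardDivisibilityPLocalized)
    (hTw : AnticyclotomicTowerSharp) :
    ∀ (W : WeierstrassCurve ℚ) [W.IsElliptic] [W.IsGloballyMinimal] (p : ℕ) [Fact p.Prime]
      [NeZero (W.conductorNorm ℤ)] (K : Type) [Field K] [NumberField K],
      Summit.BirchSwinnertonDyer.BirchSwinnertonDyer.Rank1Residual.ClassX9 W p →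
      IsImaginaryQuadratic K → Odd (NumberField.discr K) → NumberField.discr K ≠ -3 →
      SatisfiesHeegnerHypothesis (W.conductorNorm ℤ) K → SatisfiesHeegnerHypothesis p K →
      (W.baseChange K).HasIrreducibleModPGaloisRep p →
      ∀ (κ : ZpExtension K p), κ.IsAnticyclotomic → ∀ (γ : Field.absoluteGaloisGroup K),
      κ.IsTopGenerator γ →
      ∀ (Dt : ModularParametrizationData W (W.conductorNorm ℤ))
        (H : HeegnerDatum (W.conductorNorm ℤ) (NumberField.discr K)) (ιC : K →+* ℂ),
      ¬ (p : ℤ) ∣ Dt.c → (W.baseChange K).mordellWeilRank = 1 →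
      Finite (AddCommGroup.primaryComponent (W.baseChange K).sha p) →
      p ∣ NumberField.classNumber K →
      ∃ (jbar : AlgebraicClosure K →+* ℂ) (D : (W.baseChange K).LambdaAdicSelmerData κ γ)
        (F : HeegnerFamily (W.conductorNorm ℤ) W K κ jbar) (X : (W.baseChange K).SelmerDualData κ γ) (m : ℕ),
        F.Dt = Dt ∧ Ideal.span {((p : IwasawaAlgebra p) ^ m)} * heegnerCharIdeal D F ^ 2 ≤
          Module.charIdeal (IwasawaAlgebra p) (Submodule.torsion (IwasawaAlgebra p) X.X) := by
  intro W _ _ p _ _ K _ _ hX9 hK hodd h3 hHN hHp hirr κ hκ γ hγ Dt H ιC hc hrk hfin _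
  exact rung_sharp_localizedTied hNV hCGS hTw W p K hX9 hK hodd h3 hHN hHp hirr κ hκ γ hγ Dt H ιC hc hrk hfin

/-- **The rung in PACKAGE form** — same letter, conclusion = the full localized TIED package
`F.Dt = Dt ∧ 𝔛 f.g. ∧ 𝔖 f.g. ∧ 𝔖/ℋ_F Λ-torsion ∧ (p^m)·I(ℋ_F)² ⊆ char_Λ(X_tors)`, which is VERBATIM the antecedent
of the registered residual stub `Stmt.muPartSharp` (skeleton v5.1 on 27077; `PrintX9SharpMuPart.Stmt.muPartSharp`):
the residual's hypothesis is thereby discharged at EVERY light pinned frame, any class number, from `hNV`/`hCGS`/`hTw`.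
[cite: CastellaGrossiLeeSkinner2022, Thm. 4.1.1, Rem. 4.1.4 (arXiv:2008.02571)]
[cite: CastellaGrossiSkinner2025, Thm. 6.5.2 (arXiv:2303.04373)] -/
theorem rung_sharp_localizedPackage
    (hNV : CGLSHeegnerClassNonvanishing) (hCGS : CGSHowardDivisibilityPLocalized)
    (hTw : AnticyclotomicTowerSharp) :
    ∀ (W : WeierstrassCurve ℚ) [W.IsElliptic] [W.IsGloballyMinimal] (p : ℕ) [Fact p.Prime]
      [NeZero (W.conductorNorm ℤ)] (K : Type) [Field K] [NumberField K],
      Summit.BirchSwinnertonDyer.BirchSwinnertonDyer.Rank1Residual.ClassX9 W p →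
      IsImaginaryQuadratic K → Odd (NumberField.discr K) → NumberField.discr K ≠ -3 →
      SatisfiesHeegnerHypothesis (W.conductorNorm ℤ) K → SatisfiesHeegnerHypothesis p K →
      (W.baseChange K).HasIrreducibleModPGaloisRep p →
      ∀ (κ : ZpExtension K p), κ.IsAnticyclotomic → ∀ (γ : Field.absoluteGaloisGroup K),
      κ.IsTopGenerator γ →
      ∀ (Dt : ModularParametrizationData W (W.conductorNorm ℤ))
        (H : HeegnerDatum (W.conductorNorm ℤ) (NumberField.discr K)) (ιC : K →+* ℂ)
        (jbar : AlgebraicClosure K →+* ℂ),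
      ¬ (p : ℤ) ∣ Dt.c → (W.baseChange K).mordellWeilRank = 1 →
      Finite (AddCommGroup.primaryComponent (W.baseChange K).sha p) →
      ∃ (D : (W.baseChange K).LambdaAdicSelmerData κ γ)
        (F : HeegnerFamily (W.conductorNorm ℤ) W K κ jbar) (X : (W.baseChange K).SelmerDualData κ γ) (m : ℕ),
        F.Dt = Dt ∧ Module.Finite (IwasawaAlgebra p) X.X ∧ Module.Finite (IwasawaAlgebra p) D.S ∧
          Module.IsTorsion (IwasawaAlgebra p) (D.S ⧸ heegnerModule D F) ∧
          Ideal.span {((p : IwasawaAlgebra p) ^ m)} * heegnerCharIdeal D F ^ 2 ≤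
            Module.charIdeal (IwasawaAlgebra p) (Submodule.torsion (IwasawaAlgebra p) X.X) := by
  intro W _ _ p _ _ K _ _ hX9 hK hodd h3 hHN hHp hirr κ hκ γ hγ Dt H _ jbar hc _ _
  exact localizedTiedPackageAt_of_sharpBinders hNV hCGS hTw hX9 hK hodd h3 hHN hHp hirr κ hκ γ hγ Dt H jbar hc

/-! ## §3 By-ID certificates: the rung is a TRUNCATION of `A^pin` / of the crux given its binders -/

/-- **`A^pin` (item 26356 `HowardContainmentLightFramePinned`, the CONCLUSION of the deciding crux 27077) specialises to
the rung's statement** (`m := 0`; otherwise its letter): the kernel certificate that `rung_sharp_localizedTied` IS a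
truncation of the crux's conclusion BY ID. [kernel bookkeeping; no mathematical content] -/
theorem rung_isTruncation_of_pinned (hA : HowardContainmentLightFramePinned) :
    ∀ (W : WeierstrassCurve ℚ) [W.IsElliptic] [W.IsGloballyMinimal] (p : ℕ) [Fact p.Prime]
      [NeZero (W.conductorNorm ℤ)] (K : Type) [Field K] [NumberField K],
      Summit.BirchSwinnertonDyer.BirchSwinnertonDyer.Rank1Residual.ClassX9 W p →
      IsImaginaryQuadratic K → Odd (NumberField.discr K) → NumberField.discr K ≠ -3 →
      SatisfiesHeegnerHypothesis (W.conductorNorm ℤ) K → SatisfiesHeegnerHypothesis p K →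
      (W.baseChange K).HasIrreducibleModPGaloisRep p →
      ∀ (κ : ZpExtension K p), κ.IsAnticyclotomic → ∀ (γ : Field.absoluteGaloisGroup K),
      κ.IsTopGenerator γ →
      ∀ (Dt : ModularParametrizationData W (W.conductorNorm ℤ))
        (H : HeegnerDatum (W.conductorNorm ℤ) (NumberField.discr K)) (ιC : K →+* ℂ),
      ¬ (p : ℤ) ∣ Dt.c → (W.baseChange K).mordellWeilRank = 1 →
      Finite (AddCommGroup.primaryComponent (W.baseChange K).sha p) →
      ∃ (jbar : AlgebraicClosure K →+* ℂ) (D : (W.baseChange K).LambdaAdicSelmerData κ γ)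
        (F : HeegnerFamily (W.conductorNorm ℤ) W K κ jbar) (X : (W.baseChange K).SelmerDualData κ γ) (m : ℕ),
        F.Dt = Dt ∧ Ideal.span {((p : IwasawaAlgebra p) ^ m)} * heegnerCharIdeal D F ^ 2 ≤
          Module.charIdeal (IwasawaAlgebra p) (Submodule.torsion (IwasawaAlgebra p) X.X) := by
  intro W _ _ p _ _ K _ _ hX9 hK hodd h3 hHN hHp hirr κ hκ γ hγ Dt H ιC hc hrk hfin
  obtain ⟨jbar, D, F, X, hF, hle⟩ := hA W p K hX9 hK hodd h3 hHN hHp hirr κ hκ γ hγ Dt H ιC hc hrk hfin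
  refine ⟨jbar, D, F, X, 0, hF, ?_⟩
  rw [pow_zero, Ideal.span_singleton_one, Ideal.top_mul]
  exact hle

/-- **The deciding crux `HowardContainmentLightFramePinnedOfPrintSharp` (stmt-BirchSwinnertonDyer-27077), fed its four
print binders, specialises to the rung** — so under the rev-33/34 `closes` (binders `hMZ hNV hCGS hTw` and
`hA : HowardContainmentLightFramePinnedOfPrintSharp`) the rung is a truncation of what the crux delivers, BY ID.
[kernel bookkeeping; no mathematical content] -/
theorem rung_isTruncation_of_sharp (hA : HowardContainmentLightFramePinnedOfPrintSharp)
    (hMZ : MastellaZermanHowardDivisibility) (hNV : CGLSHeegnerClassNonvanishing)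
    (hCGS : CGSHowardDivisibilityPLocalized) (hTw : AnticyclotomicTowerSharp) :
    ∀ (W : WeierstrassCurve ℚ) [W.IsElliptic] [W.IsGloballyMinimal] (p : ℕ) [Fact p.Prime]
      [NeZero (W.conductorNorm ℤ)] (K : Type) [Field K] [NumberField K],
      Summit.BirchSwinnertonDyer.BirchSwinnertonDyer.Rank1Residual.ClassX9 W p →
      IsImaginaryQuadratic K → Odd (NumberField.discr K) → NumberField.discr K ≠ -3 →
      SatisfiesHeegnerHypothesis (W.conductorNorm ℤ) K → SatisfiesHeegnerHypothesis p K →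
      (W.baseChange K).HasIrreducibleModPGaloisRep p →
      ∀ (κ : ZpExtension K p), κ.IsAnticyclotomic → ∀ (γ : Field.absoluteGaloisGroup K),
      κ.IsTopGenerator γ →
      ∀ (Dt : ModularParametrizationData W (W.conductorNorm ℤ))
        (H : HeegnerDatum (W.conductorNorm ℤ) (NumberField.discr K)) (ιC : K →+* ℂ),
      ¬ (p : ℤ) ∣ Dt.c → (W.baseChange K).mordellWeilRank = 1 →
      Finite (AddCommGroup.primaryComponent (W.baseChange K).sha p) →
      ∃ (jbar : AlgebraicClosure K →+* ℂ) (D : (W.baseChange K).LambdaAdicSelmerData κ γ)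
        (F : HeegnerFamily (W.conductorNorm ℤ) W K κ jbar) (X : (W.baseChange K).SelmerDualData κ γ) (m : ℕ),
        F.Dt = Dt ∧ Ideal.span {((p : IwasawaAlgebra p) ^ m)} * heegnerCharIdeal D F ^ 2 ≤
          Module.charIdeal (IwasawaAlgebra p) (Submodule.torsion (IwasawaAlgebra p) X.X) :=
  rung_isTruncation_of_pinned (hA hMZ hNV hCGS hTw)

/-! ## §4 Both regimes of the deciding crux from its FOUR binders, BY ID, at a GIVEN `jbar` -/

/-- **Both regimes of `HowardContainmentLightFramePinnedOfPrintSharp` exercised from its four print binders** on every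
light pinned X9 frame, for the frame's own `Dt` and a GIVEN `jbar`: `p ∤ h_K` ⟹ the crux's conclusion INTEGRALLY
(`hMZ`, Mastella–Zerman Cor. 4.6 — g5's `PrintX9Rung.heegnerContainmentAt_lightTied_of_mastellaZerman`); at ANY class
number ⟹ the localized TIED package for `ℋ_F` itself (`hNV`, `hCGS`, `hTw`, §1). What separates this from the crux is
exactly the μ-part at `p ∣ h_K` (§5). BSD / BSD_p(X9) / the crux are NOT proved.
[cite: MastellaZerman2026, Cor. 4.6 (arXiv:2505.08710)] [cite: CastellaGrossiLeeSkinner2022, Thm. 4.1.1 (arXiv:2008.02571)]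
[cite: CastellaGrossiSkinner2025, Thm. 6.5.2 (arXiv:2303.04373)] -/
theorem rung_sharp_twoRegimesAt (hMZ : MastellaZermanHowardDivisibility)
    (hNV : CGLSHeegnerClassNonvanishing) (hCGS : CGSHowardDivisibilityPLocalized)
    (hTw : AnticyclotomicTowerSharp)
    {W : WeierstrassCurve ℚ} [W.IsElliptic] [W.IsGloballyMinimal] {p : ℕ} [Fact p.Prime]
    [NeZero (W.conductorNorm ℤ)] {K : Type} [Field K] [NumberField K]
    (hX9 : Summit.BirchSwinnertonDyer.BirchSwinnertonDyer.Rank1Residual.ClassX9 W p)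
    (hK : IsImaginaryQuadratic K) (hodd : Odd (NumberField.discr K)) (h3 : NumberField.discr K ≠ -3)
    (hHN : SatisfiesHeegnerHypothesis (W.conductorNorm ℤ) K) (hHp : SatisfiesHeegnerHypothesis p K)
    (hirr : (W.baseChange K).HasIrreducibleModPGaloisRep p)
    (κ : ZpExtension K p) (hκ : κ.IsAnticyclotomic)
    (γ : Field.absoluteGaloisGroup K) (hγ : κ.IsTopGenerator γ)
    (Dt : ModularParametrizationData W (W.conductorNorm ℤ))
    (H : HeegnerDatum (W.conductorNorm ℤ) (NumberField.discr K))
    (jbar : AlgebraicClosure K →+* ℂ) (hc : ¬ (p : ℤ) ∣ Dt.c) :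
    (¬ p ∣ NumberField.classNumber K →
      ∃ (D : (W.baseChange K).LambdaAdicSelmerData κ γ)
        (F : HeegnerFamily (W.conductorNorm ℤ) W K κ jbar) (X : (W.baseChange K).SelmerDualData κ γ),
        F.Dt = Dt ∧ heegnerCharIdeal D F ^ 2 ≤
          Module.charIdeal (IwasawaAlgebra p) (Submodule.torsion (IwasawaAlgebra p) X.X)) ∧
    (∃ (D : (W.baseChange K).LambdaAdicSelmerData κ γ)
      (F : HeegnerFamily (W.conductorNorm ℤ) W K κ jbar) (X : (W.baseChange K).SelmerDualData κ γ) (m : ℕ),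
      F.Dt = Dt ∧ Module.IsTorsion (IwasawaAlgebra p) (D.S ⧸ heegnerModule D F) ∧
        Ideal.span {((p : IwasawaAlgebra p) ^ m)} * heegnerCharIdeal D F ^ 2 ≤
          Module.charIdeal (IwasawaAlgebra p) (Submodule.torsion (IwasawaAlgebra p) X.X)) := by
  refine ⟨fun hhK ↦ ?_, ?_⟩
  · exact Summit.BirchSwinnertonDyer.BirchSwinnertonDyer.Theorems.PrintX9Rung.heegnerContainmentAt_lightTied_of_mastellaZerman
      hMZ hX9 hK hodd h3 hHN hHp hhK κ hκ γ hγ Dt H jbar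
  · obtain ⟨D, F, X, m, hFDt, -, -, htorF, hloc⟩ := localizedTiedPackageAt_of_sharpBinders hNV hCGS hTw hX9 hK
      hodd h3 hHN hHp hirr κ hκ γ hγ Dt H jbar hc
    exact ⟨D, F, X, m, hFDt, htorF, hloc⟩

/-! ## §5 What separates the rung from the crux: EXACTLY the μ-part (the registered residual, sharpened) -/

/-- **Given the three lever binders, the registered residual stub `Stmt.muPartSharp` (skeleton v5.1 on 27077) is
EQUIVALENT to the bare integral TIED containment at the `p ∣ h_K` frames for a GIVEN `jbar`** — its localized-package
antecedent is free (§1). So the open content of the deciding crux, beyond its four print binders, is precisely: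
`A^pin`'s conclusion at `p ∣ h_K` with `jbar` prescribed (the μ-inequality `μ(X_tors) ≤ 2μ(𝔖/ℋ_F)` suffices:
`PrintX9SharpMuPart.muPartSharp_of_muInequality`). Nothing is claimed about either side.
[cite: MastellaZerman2026, Ass. 2.1 (iii), Cor. 4.6 (arXiv:2505.08710)] [cite: CastellaGrossiSkinner2025, Thm. 6.5.2] -/
theorem muPartSharp_iff_integralTied_at_dvd
    (hNV : CGLSHeegnerClassNonvanishing) (hCGS : CGSHowardDivisibilityPLocalized)
    (hTw : AnticyclotomicTowerSharp) :
    Summit.BirchSwinnertonDyer.BirchSwinnertonDyer.Theorems.PrintX9SharpMuPart.Stmt.muPartSharp ↔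
    ∀ (W : WeierstrassCurve ℚ) [W.IsElliptic] [W.IsGloballyMinimal] (p : ℕ) [Fact p.Prime]
      [NeZero (W.conductorNorm ℤ)] (K : Type) [Field K] [NumberField K],
      Summit.BirchSwinnertonDyer.BirchSwinnertonDyer.Rank1Residual.ClassX9 W p →
      IsImaginaryQuadratic K → Odd (NumberField.discr K) → NumberField.discr K ≠ -3 →
      SatisfiesHeegnerHypothesis (W.conductorNorm ℤ) K → SatisfiesHeegnerHypothesis p K →
      (W.baseChange K).HasIrreducibleModPGaloisRep p →
      ∀ (κ : ZpExtension K p), κ.IsAnticyclotomic → ∀ (γ : Field.absoluteGaloisGroup K),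
      κ.IsTopGenerator γ →
      ∀ (Dt : ModularParametrizationData W (W.conductorNorm ℤ))
        (H : HeegnerDatum (W.conductorNorm ℤ) (NumberField.discr K)) (ιC : K →+* ℂ)
        (jbar : AlgebraicClosure K →+* ℂ),
      ¬ (p : ℤ) ∣ Dt.c → (W.baseChange K).mordellWeilRank = 1 →
      Finite (AddCommGroup.primaryComponent (W.baseChange K).sha p) →
      p ∣ NumberField.classNumber K →
      ∃ (D : (W.baseChange K).LambdaAdicSelmerData κ γ)
        (F : HeegnerFamily (W.conductorNorm ℤ) W K κ jbar) (X : (W.baseChange K).SelmerDualData κ γ),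
        F.Dt = Dt ∧ heegnerCharIdeal D F ^ 2 ≤
          Module.charIdeal (IwasawaAlgebra p) (Submodule.torsion (IwasawaAlgebra p) X.X) := by
  constructor
  · intro s_mu W _ _ p _ _ K _ _ hX9 hK hodd h3 hHN hHp hirr κ hκ γ hγ Dt H ιC jbar hc hrk hfin hhK
    exact s_mu W p K hX9 hK hodd h3 hHN hHp hirr κ hκ γ hγ Dt H ιC jbar hc hrk hfin hhK
      (localizedTiedPackageAt_of_sharpBinders hNV hCGS hTw hX9 hK hodd h3 hHN hHp hirr κ hκ γ hγ Dt H jbar hc)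
  · intro h W _ _ p _ _ K _ _ hX9 hK hodd h3 hHN hHp hirr κ hκ γ hγ Dt H ιC jbar hc hrk hfin hhK _
    exact h W p K hX9 hK hodd h3 hHN hHp hirr κ hκ γ hγ Dt H ιC jbar hc hrk hfin hhK

end Summit.BirchSwinnertonDyer.BirchSwinnertonDyer.Theorems.PrintX9SharpRung
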